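import Summits.QuantumAdvantage.AdviceFreeQNC0.FibreDecimation37
import HarnessLib

/-!
# Cell qa-qnc0, `p = 3` — ROUND-37P2 File A: the parity-coset indicator in the `𝔽₄` character basis (`indicator_coset_eq`)

Planner qa-qnc0-p2 g37, ROUND-37P2 §2 (proof of Lemma 37.D) and §6 File A: on `{0,1}^M` the indicator of the parity coset
`H_ε(M) = {w : |w| ≡ ε}` is

  `1_{H_ε}(w) = α + ω · Σ_{i ∈ M} χ_{e_i}(w)`,   `α = 1 + ε + m·ω ∈ 𝔽₄`

(`χ_{e_i}(w) = ω^{w_i}` is the general-direction character `Exp37.chiDir (Pi.single i 1)`; per coin `[w_i] = ω + ω·ω^{w_i}`).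
PROVED here: `chiDir_single` and **`indicator_coset_eq`**.  Together with `lfunChiDirLaw` (Lemma 37.D0, `FibreDecimation37Laws.lean`) this is the
input of the decimation identity Lemma 37.D (File B, not attempted here).

WHAT THIS IS NOT: Lemma 37.D / Theorem 37.F are not attempted; crux 22907 untouched; no separation.
-/

noncomputable section

namespace Summit.QuantumAdvantage.AdviceFreeQNC0.Exp37

open Finset
open Summit.QuantumAdvantage.AdviceFreeQNC0 F4

variable {m : ℕ}

/-- The character of the unit direction `e_i`: `χ_{e_i}(w) = ω^{w_i}`. -/
theorem chiDir_single (i : Fin m) (w : Fin m → Bool) :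
    chiDir (Pi.single i (1 : ZMod 3)) w = if w i then ω else 1 := by
  classical
  unfold chiDir
  rw [← Finset.mul_prod_erase univ _ (mem_univ i)]
  have h1 : ∏ j ∈ univ.erase i, (if w j = true then ω ^ ((Pi.single i (1 : ZMod 3) : Fin m → ZMod 3) j).val else 1) = 1 := by
    refine Finset.prod_eq_one fun j hj => ?_
    rw [Finset.mem_erase] at hj
    rw [Pi.single_eq_of_ne hj.1, ZMod.val_zero, pow_zero]
    split_ifs <;> rfl
  rw [h1, mul_one, Pi.single_eq_same]
  have v1 : (1 : ZMod 3).val = 1 := rfl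
  rw [v1, pow_one]

/-- The indicator of the parity coset `H_ε(M) = {w : |w| ≡ ε (mod 2)}` as an element of `𝔽₄`. -/
def cosetInd (ε : ℕ) (w : Fin m → Bool) : F4 :=
  if (univ.filter fun i => w i = true).card % 2 = ε % 2 then 1 else 0

/-- **The coset indicator in the character basis**: `1_{H_ε} = (1 + ε + m·ω) + ω·Σ_i χ_{e_i}`. -/
theorem indicator_coset_eq (ε : ℕ) (w : Fin m → Bool) :
    cosetInd ε w = (1 + (ε : F4) + (m : F4) * ω) + ω * ∑ i : Fin m, chiDir (Pi.single i (1 : ZMod 3)) w := by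
  classical
  -- per coin: `ω · χ_{e_i}(w) = ω + [w_i]`
  have hcoin : ∀ i : Fin m, ω * chiDir (Pi.single i (1 : ZMod 3)) w = ω + (if w i then 1 else 0) := by
    intro i
    rw [chiDir_single]
    split_ifs
    · rw [← pow_two, omega_sq]
    · rw [mul_one, add_zero]
  rw [Finset.mul_sum, Finset.sum_congr rfl fun i _ => hcoin i, Finset.sum_add_distrib, Finset.sum_const, Finset.card_univ,
    Fintype.card_fin, Finset.sum_boole, nsmul_eq_mul]
  -- `|w|` as a cast
  set c := (univ.filter fun i => w i = true).card with hc
  have hcast : ∀ n : ℕ, (n : F4) = if n % 2 = 1 then 1 else 0 := natCast_eq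
  unfold cosetInd
  rw [← hc]
  -- both sides are `[1 + ε + c odd]`
  have hmm : (m : F4) * ω + (m : F4) * ω = 0 := add_self _
  have key : (1 + (ε : F4) + (m : F4) * ω) + ((m : F4) * ω + (c : F4)) = ((1 + ε + c : ℕ) : F4) := by
    push_cast
    have := hmm
    linear_combination this
  rw [key, hcast (1 + ε + c)]
  by_cases h : c % 2 = ε % 2
  · rw [if_pos h, if_pos (by omega)]
  · rw [if_neg h, if_neg (by omega)]

end Summit.QuantumAdvantage.AdviceFreeQNC0.Exp37

end
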